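import Literature.Probability.Percolation.ConditionalPositiveAssociationProofs
import Literature.Probability.Percolation.TwoAvoidanceSets
import Summits.CriticalPhenomena.PercolationContinuityZ3.Theorems.PercNearOneGluingAdditiveGluingSandwichLemmaU
import Mathlib.Combinatorics.SetFamily.FourFunctions
import HarnessLib

/-!
# Crux `PercNearOneGluing.AdditiveGluing` (stmt-CriticalPhenomena-4576) — the separated-capture inequality,
# part A: restriction lemmas (BHK's identity (6) for three sources) and the conditioning identity

Helper file (task `png-dp-al5`, gen 3; `--supports stmt-CriticalPhenomena-4576`), part A of two; the induction and the
measure statements are in `…SepCapture.lean`.  Bond percolation with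
arbitrary edge probabilities on a finite vertex type (`μ = prodBernoulli w`), three vertices `o, a, b` and
vertex sets `S, T`.  Write `{o,a,b} ↮ W` for "no vertex of `W` is joined to `o`, `a` or `b`".  Then

  `μ(o↔a, o↮b, a↮b, {o,a,b}↮S) · μ(o↔b, o↮a, a↮b, {o,a,b}↮T)`
  `   ≤ μ(o↔a, o↔b, {o,a,b}↮(S∩T)) · μ(o↮a, o↮b, a↮b, {o,a,b}↮(S∪T))`            (sepCapture)

(`sepCapture_two_sets`).  With `S = T = {c}` this is the four-point partition inequality

  `P(oa|b|c) · P(ob|a|c) ≤ P(oab|c) · P(o|a|b|c)`                                        (V1)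

(`sepCapture_three`; blocks of the partition of `{o,a,b,c}` induced by the open clusters), the "fully
separated" sharpening of the captured-set inequality `P(S={a})P(S={b}) ≤ P(S={a,b})P(S=∅)` of
`Literature/Probability/Percolation/TwoAvoidanceSets.lean` (`capturedSet_mul_le`, BHK 2006 Thm. 1.1): the
third relay `c` is kept ISOLATED on the right-hand side too.  It is not an instance of the Harris /
Ahlswede–Daykin four-event inequality (the join of two configurations in which `c` is isolated need not
isolate `c`), nor of BHK's Thms. 1.1/1.5 (the events are not measurable with respect to one or two clusters);
numerically it is one of the few "dilution-free" quadratic relations among the four-terminal partition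
probabilities (memo R3-REALIZABILITY.md of the item).

## Proof (van den Berg–Kahn 2001, method of Thm. 1.2; BHK 2006 pp. 3–5)

Exactly the induction of [VandenbergKahn2001] / [VandenbergHaggstromKahn2005, Thm. 1.1] as formalised in
`ConditionalPositiveAssociationProofs.lean` (`BHK2006.core`), for percolation restricted to a vertex set `U`:
if `Z := S ∩ T = ∅` the inequality (with `μ(o↔a, o↔b)` unrestricted on the right) is the Ahlswede–Daykin four
functions theorem on the configuration lattice (`{o↔a}`, `{o↔b}` are up-sets; `{o↮b, a↮b, {o,a,b}↮S}`,
`{o↮a, a↮b, {o,a,b}↮T}` are down-sets whose intersection is the fully separated event); if `Z ≠ ∅`,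
condition on the random set `R` of vertices of `U ∖ Z` joined to `Z` by an open edge: on `{o,a,b} ↮ Z` every
event above is the corresponding event of `G[U ∖ Z]` with `Z` replaced by `R` (BHK's identity (6), here
for the three sources `o, a, b` at once), the law of `R` is a product weight, and the four functions
theorem with the induction hypothesis for `G[U ∖ Z]` (sets `(S∖Z) ∪ R`, `(T∖Z) ∪ R'`, whose intersection
contains `R ∩ R'` and whose union is `(S∪T)∖Z ∪ (R ∪ R')`) closes the induction.

## References
* J. van den Berg, J. Kahn, *A correlation inequality for connection events in percolation*, Ann. Probab.
  29 (2001) 123–126, Thm. 1.2 and its proof (pp. 124–126). [VandenbergKahn2001]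
* J. van den Berg, O. Häggström, J. Kahn, RSA 29 (2006) 417–435, Thm. 1.1 (pp. 3–5). [VandenbergHaggstromKahn2005]
* R. Ahlswede, D. E. Daykin, Z. Wahrsch. Verw. Gebiete 43 (1978) 183–185 (Mathlib `four_functions_theorem_univ`).
-/

noncomputable section

open MeasureTheory
open Literature.Probability.LatticeModels (prodBernoulli)
open Literature.Probability.Percolation
open Literature.Probability.Percolation.BHK2006
open DecisionTree (ind ind_of_mem ind_of_not_mem ind_nonneg)

namespace Summit.CriticalPhenomena.PercolationContinuityZ3.Theorems

open scoped Classical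

variable {V : Type*}

/-! Local notations (no new definitions): `rR[U, x, y]` = `{x ↔ y in G[U]}`; `rAV[U, o, a, b, W]` =
`{o ↮ W} ∩ {a ↮ W} ∩ {b ↮ W}` in `G[U]` (BHK's `R_W` for the three sources). -/
local notation3 "rR[" U ", " x ", " y "]" =>
  {ω : Set (Sym2 V) | (openGraph (ω ∩ edgesIn U)).Reachable x y}
local notation3 "rAV[" U ", " o ", " a ", " b ", " W "]" => rD U o W ∩ rD U a W ∩ rD U b W

/-! ### Restriction to `G[U ∖ Z]` on the event that the three sources avoid `Z` -/

section Graph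

/-- Reachability in `G[U ∖ Z]` implies reachability in `G[U]`. [folklore] -/
theorem sepCapture_reach_mono {U Z : Finset V} {ω : Set (Sym2 V)} {x y : V}
    (h : (openGraph (ω ∩ edgesIn (U \ Z))).Reachable x y) :
    (openGraph (ω ∩ edgesIn U)).Reachable x y :=
  h.mono (openGraph_le (Set.inter_subset_inter_right _ (edgesIn_mono Finset.sdiff_subset)))

/-- The edges meeting `Z` do not affect reachability in `G[U ∖ Z]`. [folklore] -/
theorem sepCapture_reach_diff_meeting (U Z : Finset V) (ω : Set (Sym2 V)) (x y : V) :
    (openGraph ((ω \ meeting Z) ∩ edgesIn (U \ Z))).Reachable x y ↔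
      (openGraph (ω ∩ edgesIn (U \ Z))).Reachable x y := by
  rw [diff_meeting_inter_edgesIn]

end Graph

/-! ### The four event families -/

section Events

/-! `E1[U, o, a, b, W]` = `{o↔a, o↮b, a↮b, {o,a,b}↮W}` ("`o` captures exactly `a`, everything else
separated"), `EJ` = `{o↔a, o↔b, {o,a,b}↮W}`, `ES` = `{o↮a, o↮b, a↮b, {o,a,b}↮W}` in `G[U]`. -/
local notation3 "E1[" U ", " o ", " a ", " b ", " W "]" =>
  rR[U, o, a] ∩ (rR[U, o, b])ᶜ ∩ (rR[U, a, b])ᶜ ∩ rAV[U, o, a, b, W]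
local notation3 "EJ[" U ", " o ", " a ", " b ", " W "]" =>
  rR[U, o, a] ∩ rR[U, o, b] ∩ rAV[U, o, a, b, W]
local notation3 "ES[" U ", " o ", " a ", " b ", " W "]" =>
  (rR[U, o, a])ᶜ ∩ (rR[U, o, b])ᶜ ∩ (rR[U, a, b])ᶜ ∩ rAV[U, o, a, b, W]

/-- The avoidance event `{o,a,b} ↮ W` of `G[U ∖ Z]` does not read the edges meeting `Z`. [folklore] -/
theorem sepCapture_av_diff_meeting (U Z : Finset V) (o a b : V) (W : Set V) (ω : Set (Sym2 V)) :
    ω \ meeting Z ∈ rAV[U \ Z, o, a, b, W] ↔ ω ∈ rAV[U \ Z, o, a, b, W] := by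
  simp only [Set.mem_inter_iff, mem_rD_diff_meeting]

/-- Reachability events of `G[U ∖ Z]` do not read the edges meeting `Z`. [folklore] -/
theorem sepCapture_rR_diff_meeting (U Z : Finset V) (x y : V) (ω : Set (Sym2 V)) :
    ω \ meeting Z ∈ rR[U \ Z, x, y] ↔ ω ∈ rR[U \ Z, x, y] := by
  simp only [Set.mem_setOf_eq, sepCapture_reach_diff_meeting]

/-- BHK's identity (6) for the three sources at once: for `Z ⊆ W`, `{o,a,b} ↮ W` in `G[U]` iff
`{o,a,b} ↮ (W ∖ Z) ∪ S(ω)` in `G[U ∖ Z]`. [cite: VandenbergHaggstromKahn2005, §1 p. 4, identity (6)] -/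
theorem sepCapture_av_iff {U Z : Finset V} (hZU : Z ⊆ U) {o a b : V} (ho : o ∉ Z) (ha : a ∉ Z)
    (hb : b ∉ Z) {W : Set V} (hZW : (↑Z : Set V) ⊆ W) (ω : Set (Sym2 V)) :
    ω ∈ rAV[U, o, a, b, W] ↔ ω ∈ rAV[U \ Z, o, a, b, (W \ ↑Z) ∪ rS U Z ω] := by
  simp only [Set.mem_inter_iff]
  rw [mem_rD_iff_restrict hZU ho hZW, mem_rD_iff_restrict hZU ha hZW, mem_rD_iff_restrict hZU hb hZW]

/-- On the restricted avoidance event, a source avoids `S(ω)` in `G[U ∖ Z]`. [folklore] -/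
theorem sepCapture_avoid_rS {U Z : Finset V} {x : V} {W' : Set V} {ω : Set (Sym2 V)}
    (h : ω ∈ rD (U \ Z) x (W' ∪ rS U Z ω)) :
    ∀ n ∈ rS U Z ω, ¬ (openGraph (ω ∩ edgesIn (U \ Z))).Reachable x n :=
  fun n hn => h n (Or.inr hn)

/-- `E1` does not read the edges meeting `Z` (in `G[U ∖ Z]`). [folklore] -/
theorem sepCapture_E1_diff_meeting (U Z : Finset V) (o a b : V) (W : Set V) (ω : Set (Sym2 V)) :
    ω \ meeting Z ∈ E1[U \ Z, o, a, b, W] ↔ ω ∈ E1[U \ Z, o, a, b, W] := by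
  simp only [Set.mem_inter_iff, Set.mem_compl_iff, sepCapture_rR_diff_meeting, mem_rD_diff_meeting]

/-- `EJ` does not read the edges meeting `Z`. [folklore] -/
theorem sepCapture_EJ_diff_meeting (U Z : Finset V) (o a b : V) (W : Set V) (ω : Set (Sym2 V)) :
    ω \ meeting Z ∈ EJ[U \ Z, o, a, b, W] ↔ ω ∈ EJ[U \ Z, o, a, b, W] := by
  simp only [Set.mem_inter_iff, sepCapture_rR_diff_meeting, mem_rD_diff_meeting]

/-- `ES` does not read the edges meeting `Z`. [folklore] -/
theorem sepCapture_ES_diff_meeting (U Z : Finset V) (o a b : V) (W : Set V) (ω : Set (Sym2 V)) :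
    ω \ meeting Z ∈ ES[U \ Z, o, a, b, W] ↔ ω ∈ ES[U \ Z, o, a, b, W] := by
  simp only [Set.mem_inter_iff, Set.mem_compl_iff, sepCapture_rR_diff_meeting, mem_rD_diff_meeting]

/-- BHK's (6) for `E1`: for `Z ⊆ W` avoiding the terminals, `ω ∈ E1[U, W]` iff
`ω ∈ E1[U ∖ Z, (W ∖ Z) ∪ S(ω)]`. [cite: VandenbergHaggstromKahn2005, §1 p. 4, identity (6)] -/
theorem sepCapture_E1_iff {U Z : Finset V} (hZU : Z ⊆ U) {o a b : V} (ho : o ∉ Z) (ha : a ∉ Z)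
    (hb : b ∉ Z) {W : Set V} (hZW : (↑Z : Set V) ⊆ W) (ω : Set (Sym2 V)) :
    ω ∈ E1[U, o, a, b, W] ↔ ω ∈ E1[U \ Z, o, a, b, (W \ ↑Z) ∪ rS U Z ω] := by
  constructor
  · rintro ⟨⟨⟨hoa, hob⟩, hab⟩, hav⟩
    have hav' := (sepCapture_av_iff hZU ho ha hb hZW ω).1 hav
    have hSo := sepCapture_avoid_rS hav'.1.1
    have hSa := sepCapture_avoid_rS hav'.1.2
    refine ⟨⟨⟨(SandwichK41.reachable_restrict_iff ho hSo a).1 hoa, fun h => hob (sepCapture_reach_mono h)⟩,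
      fun h => hab (sepCapture_reach_mono h)⟩, hav'⟩
  · rintro ⟨⟨⟨hoa, hob⟩, hab⟩, hav'⟩
    have hav := (sepCapture_av_iff hZU ho ha hb hZW ω).2 hav'
    have hSo := sepCapture_avoid_rS hav'.1.1
    have hSa := sepCapture_avoid_rS hav'.1.2
    exact ⟨⟨⟨sepCapture_reach_mono hoa, fun h => hob ((SandwichK41.reachable_restrict_iff ho hSo b).1 h)⟩,
      fun h => hab ((SandwichK41.reachable_restrict_iff ha hSa b).1 h)⟩, hav⟩

/-- BHK's (6) for `EJ`. [cite: VandenbergHaggstromKahn2005, §1 p. 4, identity (6)] -/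
theorem sepCapture_EJ_iff {U Z : Finset V} (hZU : Z ⊆ U) {o a b : V} (ho : o ∉ Z) (ha : a ∉ Z)
    (hb : b ∉ Z) {W : Set V} (hZW : (↑Z : Set V) ⊆ W) (ω : Set (Sym2 V)) :
    ω ∈ EJ[U, o, a, b, W] ↔ ω ∈ EJ[U \ Z, o, a, b, (W \ ↑Z) ∪ rS U Z ω] := by
  constructor
  · rintro ⟨⟨hoa, hob⟩, hav⟩
    have hav' := (sepCapture_av_iff hZU ho ha hb hZW ω).1 hav
    have hSo := sepCapture_avoid_rS hav'.1.1
    exact ⟨⟨(SandwichK41.reachable_restrict_iff ho hSo a).1 hoa, (SandwichK41.reachable_restrict_iff ho hSo b).1 hob⟩, hav'⟩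
  · rintro ⟨⟨hoa, hob⟩, hav'⟩
    exact ⟨⟨sepCapture_reach_mono hoa, sepCapture_reach_mono hob⟩,
      (sepCapture_av_iff hZU ho ha hb hZW ω).2 hav'⟩

/-- BHK's (6) for `ES`. [cite: VandenbergHaggstromKahn2005, §1 p. 4, identity (6)] -/
theorem sepCapture_ES_iff {U Z : Finset V} (hZU : Z ⊆ U) {o a b : V} (ho : o ∉ Z) (ha : a ∉ Z)
    (hb : b ∉ Z) {W : Set V} (hZW : (↑Z : Set V) ⊆ W) (ω : Set (Sym2 V)) :
    ω ∈ ES[U, o, a, b, W] ↔ ω ∈ ES[U \ Z, o, a, b, (W \ ↑Z) ∪ rS U Z ω] := by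
  constructor
  · rintro ⟨⟨⟨hoa, hob⟩, hab⟩, hav⟩
    have hav' := (sepCapture_av_iff hZU ho ha hb hZW ω).1 hav
    exact ⟨⟨⟨fun h => hoa (sepCapture_reach_mono h), fun h => hob (sepCapture_reach_mono h)⟩,
      fun h => hab (sepCapture_reach_mono h)⟩, hav'⟩
  · rintro ⟨⟨⟨hoa, hob⟩, hab⟩, hav'⟩
    have hav := (sepCapture_av_iff hZU ho ha hb hZW ω).2 hav'
    have hSo := sepCapture_avoid_rS hav'.1.1
    have hSa := sepCapture_avoid_rS hav'.1.2
    exact ⟨⟨⟨fun h => hoa ((SandwichK41.reachable_restrict_iff ho hSo a).1 h),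
      fun h => hob ((SandwichK41.reachable_restrict_iff ho hSo b).1 h)⟩,
      fun h => hab ((SandwichK41.reachable_restrict_iff ha hSa b).1 h)⟩, hav⟩

/-- The avoidance events are antitone in the avoided set. [cite: VandenbergHaggstromKahn2005, §1 p. 3] -/
theorem sepCapture_av_antitone (U : Finset V) (o a b : V) {W W' : Set V} (h : W ⊆ W') :
    rAV[U, o, a, b, W'] ⊆ rAV[U, o, a, b, W] := fun _ ⟨⟨h1, h2⟩, h3⟩ =>
  ⟨⟨rD_antitone h h1, rD_antitone h h2⟩, rD_antitone h h3⟩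

variable [Fintype V]

/-- `μ(E) ≥ 0` for the weight sums. [folklore] -/
theorem sepCapture_sum_nonneg {w : Sym2 V → ℝ} (hw0 : ∀ e, 0 ≤ w e) (hw1 : ∀ e, w e ≤ 1)
    (E : Set (Set (Sym2 V))) : 0 ≤ ∑ ω, weight w ω * ind E ω :=
  Finset.sum_nonneg fun ω _ => mul_nonneg (weight_nonneg hw0 hw1 ω) (ind_nonneg _ _)

/-- Monotonicity of the weight sum in the event. [folklore] -/
theorem sepCapture_sum_mono {w : Sym2 V → ℝ} (hw0 : ∀ e, 0 ≤ w e) (hw1 : ∀ e, w e ≤ 1)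
    {E E' : Set (Set (Sym2 V))} (h : E ⊆ E') :
    ∑ ω, weight w ω * ind E ω ≤ ∑ ω, weight w ω * ind E' ω :=
  Finset.sum_le_sum fun ω _ => mul_le_mul_of_nonneg_left (ind_mono h ω) (weight_nonneg hw0 hw1 ω)

/-- **BHK's (6), summed, for an event family**: if membership of `ω` in `E` is membership of `ω` in the
event `E' (B ∪ S(ω))` of `G[U ∖ Z]`, and the events `E'` do not read the edges meeting `Z`, then
`μ(E) = Σ_ω weight(ω) · μ(E' (B ∪ S(ω)))`.
[cite: VandenbergHaggstromKahn2005, §1 p. 4, display before (5) and identity (6)] -/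
theorem sepCapture_step_sum {U Z : Finset V} (w : Sym2 V → ℝ) (hm : ∑ ω, weight w ω = 1)
    (E : Set (Set (Sym2 V))) (E' : Set V → Set (Set (Sym2 V))) (B : Set V)
    (hE' : ∀ (R : Set V) (ω : Set (Sym2 V)), ω \ meeting Z ∈ E' (B ∪ R) ↔ ω ∈ E' (B ∪ R))
    (hE : ∀ ω, ω ∈ E ↔ ω ∈ E' (B ∪ rS U Z ω)) :
    ∑ ω, weight w ω * ind E ω =
      ∑ ω, weight w ω * ∑ η, weight w η * ind (E' (B ∪ rS U Z ω)) η := by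
  set A := meeting Z with hA
  set Φ : Set (Sym2 V) → Set (Sym2 V) → ℝ := fun ζ η => ind (E' (B ∪ rS U Z ζ)) η with hΦ
  have h1 : ∀ ω, ind E ω = Φ (ω ∩ A) (ω \ A) := by
    intro ω
    simp only [hΦ, hA, rS_inter_meeting]
    by_cases hω : ω ∈ E
    · rw [ind_of_mem hω, ind_of_mem ((hE' _ ω).2 ((hE ω).1 hω))]
    · rw [ind_of_not_mem hω, ind_of_not_mem (fun h => hω ((hE ω).2 ((hE' _ ω).1 h)))]
  have h2 : ∀ ω ω', Φ (ω ∩ A) (ω' \ A) = ind (E' (B ∪ rS U Z ω)) ω' := by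
    intro ω ω'
    simp only [hΦ, hA, rS_inter_meeting]
    by_cases hω' : ω' ∈ E' (B ∪ rS U Z ω)
    · rw [ind_of_mem hω', ind_of_mem ((hE' _ ω').2 hω')]
    · rw [ind_of_not_mem hω', ind_of_not_mem (fun h => hω' ((hE' _ ω').1 h))]
  calc ∑ ω, weight w ω * ind E ω
      = (∑ ω, weight w ω) * ∑ ω, weight w ω * Φ (ω ∩ A) (ω \ A) := by
        rw [hm, one_mul]; simp_rw [h1]
    _ = ∑ ω, weight w ω * ∑ ω', weight w ω' * Φ (ω ∩ A) (ω' \ A) := blockFubini w A Φ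
    _ = ∑ ω, weight w ω * ∑ η, weight w η * ind (E' (B ∪ rS U Z ω)) η := by
        simp_rw [h2]

end Events

end Summit.CriticalPhenomena.PercolationContinuityZ3.Theorems

end
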